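import Summits.BirchSwinnertonDyer.BirchSwinnertonDyer.Theorems.ClassRecordThreeEulerHalvesAtThreeJetchevNecessary
import Summits.BirchSwinnertonDyer.BirchSwinnertonDyer.Theorems.ClassRecordThreeEulerHalvesAtThreeJetchevHL

/-!
# Route `ClassRecordThree` (rung K2@3), crux 5 `EulerHalvesAtThree` (item 19109, shared by
# `KolyvaginRoadThree`): the (ram) content of the crux ⟺ J₃ʳ♭, clause (0) ⟺ J₃⁰♭ (given TL₃) — the
# EQUIVALENCE record (cell `bsd-stepL`, seat `bsd-stepL-tam3-p1`, session g2; `--supports stmt-BirchSwinnertonDyer-19109 --as helper`)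

Punchline of this seat's files 5–7 (`…JetchevTight.lean` p424857, `…JetchevNecessary.lean` p427482,
`…JetchevHL.lean` p427657) in two `Iff`s, modulo the published named facts (Gross–Zagier, Kolyvagin, Skinner 2016
Thm C, Wuthrich 2014 Prop 21, GZK, modularity, newforms, Hoffstein–Luo, Mazur, Shimura reciprocity at conductor 1,
Darmon 2004 Thm 3.6, McCallum 1991 Cor 5.6 in both one-sided readings):

* `upperHalfRam_iff_jetchevDivisibilityRamHL` — the Euler-system half `Typed.MissingUpperBoundAt W 3` on ALL of
  X11b@3 ∧ (ram) ⟺ J₃ʳ♭ (global `3^s`-divisibility of the derived Heegner points to depth `ord₃ ∏ c_ℓ(E)` at every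
  Manin-good conductor-1 frame over every Hoffstein–Luo-type Heegner field of every such curve; = McCallum's
  `M_∞ ≥ t` on the tree's objects by file 5 §2).
* `eulerSurjClause_iff_jetchevDivisibilityNotRamHL_of_twistLower` — GIVEN TL₃ (the (ram)-free rank-`0` `3`-part
  lower bound, needed only for ⟸), clause (0) of the crux verbatim ⟺ J₃⁰♭.

HONEST FRAMING. Equivalences between OPEN statements; nothing on either side is proved; no item closes; CONDITIONAL
on the listed published facts (all `def … : Prop` named facts of the tree or theorems). What it settles: the
registered Jetchev stubs of item 19109, narrowed to the frames used, are EXACTLY as hard as the crux clauses they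
serve (no strength lost or added by the reduction), and «`M_∞ ≥ t` at `3 ∥ N`» is thereby the Heegner-point
restatement of the Tamagawa-sharp upper half of `BSD₃` on X11b@3.

References: [McCallumLMS1991] §5 Cor. 5.6; [Wuthrich2014] Prop. 21; [Skinner2016PacificMC] Thm. C;
[JetchevSkinnerWan2017] §7.4; [Jetchev2008] Conj. 1.3; files p419384, p419735, p424857, p427482, p427657.
-/

noncomputable section

open scoped Classical

namespace Summit.BirchSwinnertonDyer.Rank1Residual.X11b.Three.Koly

open WeierstrassCurve Literature.NumberTheory.EllipticCurves
  Literature.NumberTheory.EllipticCurves.ModularForms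
  Literature.NumberTheory.EllipticCurves.Rank1Residual
  Literature.NumberTheory.EllipticCurves.Wuthrich2014
  Summit.BirchSwinnertonDyer.Rank1Residual Summit.BirchSwinnertonDyer.Rank1Residual.X11b

/-- **The Euler-system half on X11b@3 ∧ (ram) ⟺ J₃ʳ♭**, modulo the published named facts listed as binders
(⟹: `jetchevDivisibilityRamHL_of_upperHalfRam`, file 6 — uses Wuthrich `hWu` and McCallum's certificate form
`hMcL`; ⟸: `missingUpperBoundAt_three_of_classX11b_of_ram_of_jetchevDivisibilityHL`, file 7 — uses Skinner Thm C
`hSk`, Hoffstein–Luo `hHL`, Mazur `hMaz`, newforms `hnf`, McCallum's upper form `hMcU`). CONDITIONAL on every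
binder; nothing asserted about either side. [cite: McCallumLMS1991, §5 Cor. 5.6 (p. 310)]
[cite: Wuthrich2014, Prop. 21 (p. 400)] [cite: Skinner2016PacificMC, Thm. C (§1)] [cite: Jetchev2008, Conj. 1.3 (p. 812)] -/
theorem upperHalfRam_iff_jetchevDivisibilityRamHL
    (hGZ : ∀ (N : ℕ) [NeZero N] (W : WeierstrassCurve ℚ) (K : Type) [Field K] [NumberField K],
      gross_zagier N W K)
    (hKo : ∀ (N : ℕ) [NeZero N] (W : WeierstrassCurve ℚ) (K : Type) [Field K] [NumberField K],
      kolyvagin N W K)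
    (hSk : Skinner2016.thmC_padicValRat_bsd_rank_zero) (hWu : sha_dvd_analyticSha)
    (hGZK : rank_eq_analyticRank_of_analyticRank_le_one) (hmod : hasEntireLFunction_rat)
    (hnf : exists_isNewformOf) (hHL : HoffsteinLuo1997_exists_twist_L_one_ne_zero)
    (hMaz : mazur_not_dvd_maninConstant_of_odd)
    (hrec : ∀ (N : ℕ) [NeZero N] (W : WeierstrassCurve ℚ) (K : Type) [Field K] [NumberField K],
      heegnerPointOfConductor_one_galoisConj N W K)
    (hD36 : ∀ (N : ℕ) [NeZero N] (W : WeierstrassCurve ℚ) (K : Type) [Field K] [NumberField K],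
      phi_heegnerTau_mem_singularModuliField N W K)
    (hMcU : McCallum1991_padicValNat_card_sha_primary_add_le_of_globalDivisibility)
    (hMcL : McCallum1991_pow_dvd_card_sha_primary_of_certificate) :
    (∀ (W : WeierstrassCurve ℚ) [W.IsElliptic] [W.IsGloballyMinimal],
        ClassX11b W 3 → Ram W 3 → Typed.MissingUpperBoundAt W 3) ↔
    (∀ (W : WeierstrassCurve ℚ) [W.IsElliptic] [W.IsGloballyMinimal] [NeZero (W.conductorNorm ℤ)]
      (K : Type) [Field K] [NumberField K]
      (Dt : ModularParametrizationData W (W.conductorNorm ℤ)) (β : ℤ) (ι : K →+* ℂ),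
      W.analyticRank = 1 → W.HasMultiplicativeReductionAtPrime 3 → Surj W 3 → Ram W 3 →
      IsImaginaryQuadratic K → SatisfiesHeegnerHypothesis (W.conductorNorm ℤ) K →
      Odd (NumberField.discr K) → (W.quadraticTwist (NumberField.discr K : ℚ)).entireLFunction 1 ≠ 0 →
      (4 * (W.conductorNorm ℤ : ℤ)) ∣ β ^ 2 - NumberField.discr K → ¬ (3 : ℤ) ∣ Dt.c →
      ∀ (s : ℕ), s ≤ padicValNat 3 W.tamagawaProduct →
        ∀ (n : ℕ) (d : KolyvaginHeegnerData Dt β ι n), Squarefree n →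
          (∀ ℓ ∈ n.primeFactors, Zhang2014.IsKolyvaginPrime (W.conductorNorm ℤ) W K 3 ℓ ∧
            s ≤ Zhang2014.kolyvaginIndex W 3 ℓ) → PDiv d 3 s) :=
  ⟨fun h ↦ jetchevDivisibilityRamHL_of_upperHalfRam hGZ hKo hWu hGZK hmod hrec hD36 hMcL h,
    fun hJ W _ _ hX hram ↦ missingUpperBoundAt_three_of_classX11b_of_ram_of_jetchevDivisibilityHL hGZ hKo hSk
      hGZK hmod hnf hHL hMaz hrec hD36 hMcU hJ W hX hram⟩

/-- **Clause (0) of the crux ⟺ J₃⁰♭, given TL₃**, modulo the published named facts (⟹: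
`jetchevDivisibilityNotRamHL_of_eulerSurjClause`, file 6, does not use TL₃; ⟸:
`missingUpperBoundAt_three_of_classX11b_of_surj_of_not_ram_of_jetchevDivisibilityHL_of_twistLower`, file 7, uses
TL₃ `hTL` for the twist's rank-`0` lower half). CONDITIONAL on every binder (TL₃ is OPEN); nothing asserted
about either side. [cite: McCallumLMS1991, §5 Cor. 5.6 (p. 310)] [cite: Wuthrich2014, Prop. 21 (p. 400)]
[cite: Skinner2016PacificMC, Thm. C (§1) — shape of TL₃] -/
theorem eulerSurjClause_iff_jetchevDivisibilityNotRamHL_of_twistLower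
    (hGZ : ∀ (N : ℕ) [NeZero N] (W : WeierstrassCurve ℚ) (K : Type) [Field K] [NumberField K],
      gross_zagier N W K)
    (hKo : ∀ (N : ℕ) [NeZero N] (W : WeierstrassCurve ℚ) (K : Type) [Field K] [NumberField K],
      kolyvagin N W K)
    (hWu : sha_dvd_analyticSha)
    (hGZK : rank_eq_analyticRank_of_analyticRank_le_one) (hmod : hasEntireLFunction_rat)
    (hnf : exists_isNewformOf) (hHL : HoffsteinLuo1997_exists_twist_L_one_ne_zero)
    (hMaz : mazur_not_dvd_maninConstant_of_odd)
    (hrec : ∀ (N : ℕ) [NeZero N] (W : WeierstrassCurve ℚ) (K : Type) [Field K] [NumberField K],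
      heegnerPointOfConductor_one_galoisConj N W K)
    (hD36 : ∀ (N : ℕ) [NeZero N] (W : WeierstrassCurve ℚ) (K : Type) [Field K] [NumberField K],
      phi_heegnerTau_mem_singularModuliField N W K)
    (hMcU : McCallum1991_padicValNat_card_sha_primary_add_le_of_globalDivisibility)
    (hMcL : McCallum1991_pow_dvd_card_sha_primary_of_certificate)
    -- OPEN INPUT TL₃ (used for ⟸ only)
    (hTL : ∀ (V : WeierstrassCurve ℚ) [V.IsElliptic] [V.IsGloballyMinimal],
      V.HasMultiplicativeReductionAtPrime 3 → V.HasIrreducibleModPGaloisRep 3 →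
      V.entireLFunction 1 ≠ 0 → Finite V.sha →
      ∃ q : ℚ, V.entireLFunction 1 / (V.realPeriodRat : ℂ) = (q : ℂ) ∧
        padicValRat 3 q ≤ (padicValNat 3 V.shaOrder : ℤ) + padicValNat 3 V.tamagawaProduct -
          2 * padicValNat 3 V.torsionOrder) :
    (∀ (W : WeierstrassCurve ℚ) [W.IsElliptic] [W.IsGloballyMinimal],
        ClassX11b W 3 → Surj W 3 → ¬ Ram W 3 → Typed.MissingUpperBoundAt W 3) ↔
    (∀ (W : WeierstrassCurve ℚ) [W.IsElliptic] [W.IsGloballyMinimal] [NeZero (W.conductorNorm ℤ)]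
      (K : Type) [Field K] [NumberField K]
      (Dt : ModularParametrizationData W (W.conductorNorm ℤ)) (β : ℤ) (ι : K →+* ℂ),
      W.analyticRank = 1 → W.HasMultiplicativeReductionAtPrime 3 → Surj W 3 → ¬ Ram W 3 →
      IsImaginaryQuadratic K → SatisfiesHeegnerHypothesis (W.conductorNorm ℤ) K →
      Odd (NumberField.discr K) → (W.quadraticTwist (NumberField.discr K : ℚ)).entireLFunction 1 ≠ 0 →
      (4 * (W.conductorNorm ℤ : ℤ)) ∣ β ^ 2 - NumberField.discr K → ¬ (3 : ℤ) ∣ Dt.c →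
      ∀ (s : ℕ), s ≤ padicValNat 3 W.tamagawaProduct →
        ∀ (n : ℕ) (d : KolyvaginHeegnerData Dt β ι n), Squarefree n →
          (∀ ℓ ∈ n.primeFactors, Zhang2014.IsKolyvaginPrime (W.conductorNorm ℤ) W K 3 ℓ ∧
            s ≤ Zhang2014.kolyvaginIndex W 3 ℓ) → PDiv d 3 s) :=
  ⟨fun h ↦ jetchevDivisibilityNotRamHL_of_eulerSurjClause hGZ hKo hWu hGZK hmod hrec hD36 hMcL h,
    fun hJ0 W _ _ hX hρ hnram ↦
      missingUpperBoundAt_three_of_classX11b_of_surj_of_not_ram_of_jetchevDivisibilityHL_of_twistLower hGZ hKo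
        hGZK hmod hnf hHL hMaz hrec hD36 hMcU hJ0 hTL W hX hρ hnram⟩

end Summit.BirchSwinnertonDyer.Rank1Residual.X11b.Three.Koly

end
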